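import Summits.CriticalPhenomena.Ising3DConformalLimit.Theses.LinkingParityCircles
import Summits.CriticalPhenomena.Ising3DConformalLimit.Theorems.LinkingParityCirclesSpinRatioMoebiusRootCensus
import Summits.CriticalPhenomena.Ising3DConformalLimit.Theorems.MonotoneBlockingLimitsAreConformalSummit
import Summits.CriticalPhenomena.Ising3DConformalLimit.Theorems.HyperoctahedralRPExistsScaleCovariantLimitSplitGlue

/-!
# SplitR1 certificate — POSITIVE CONTROLS (must be rc 0, no sorry) for the r1 redirect of crux `LinkingParityCircles.SpinRatioMoebius` (stmt-4530):
(I1) the costume: item 1344's body is the sub-problem's body with the last conjunct `HasNontrivialU4 S` deleted, and X ⇔ 1344;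
(I2) S → X (the crux is a CONSEQUENCE of the sub-problem);  (I3) X ∧ 0636 → S (the complement is exactly clause (iii));
(I4) the split glue at ROUTE-LOCAL COPIES of the three pieces (δ-unfolding test for the glue item the gate will render);
(I5) EXACTNESS X ⇔ X1 ∧ X2 ∧ X3 and NECESSITY of each piece;  (I6) S ⇔ (X1 ∧ X2) ∧ X3 ∧ 0636 (the cone after the split is a
named conjunct split of S).
-/

namespace H21Probe.SpinRatioMoebiusInfo

open Literature.Probability.LatticeModels
open Summit.CriticalPhenomena.Ising3DConformalLimit.Theses
open Summit.CriticalPhenomena.Ising3DConformalLimit.Cruxes.SpinRatioMoebius.Birth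
open Summit.CriticalPhenomena.Ising3DConformalLimit.Theorems.LimitsAreConformalSummit
open Summit.CriticalPhenomena.Ising3DConformalLimit.MoebiusLimitExistsOnlyInteraction
  (existsScaleCovariantLimit_of_MoebiusLimitExists inversionUpgradeNormalised_of_MoebiusLimitExists)

/-! ### (I1) the costume -/

/-- The sub-problem, unfolded. -/
theorem info_summit_body : _root_.Ising3DConformalLimit ↔
    ∃ (ρ : ℝ → ℝ) (Δ : ℝ) (S : CorrFamily 3), (∀ δ ∈ Set.Ioc (0 : ℝ) 1, 0 < ρ δ) ∧ 0 < Δ ∧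
      HasPointwiseScalingLimit (criticalCorr 3) ρ S ∧ IsNondegenerateTwoPoint S ∧ IsMoebiusCovariant Δ S ∧ HasNontrivialU4 S :=
  Iff.rfl

/-- Item 1344 (`EnergyNotSigmaSquared.MoebiusLimit`), unfolded: the same body WITHOUT the last conjunct. -/
theorem info_1344_body : EnergyNotSigmaSquared.MoebiusLimit ↔
    ∃ (ρ : ℝ → ℝ) (Δ : ℝ) (S : CorrFamily 3), (∀ δ ∈ Set.Ioc (0 : ℝ) 1, 0 < ρ δ) ∧ 0 < Δ ∧
      HasPointwiseScalingLimit (criticalCorr 3) ρ S ∧ IsNondegenerateTwoPoint S ∧ IsMoebiusCovariant Δ S :=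
  Iff.rfl

/-- X ⇔ 1344 (landed p157687). -/
theorem info_X_iff_1344 : LinkingParityCircles.SpinRatioMoebius ↔ EnergyNotSigmaSquared.MoebiusLimit :=
  SpinRatioMoebius_iff_moebiusLimit

/-! ### (I2) `S → X` -/

theorem info_S_X : _root_.Ising3DConformalLimit → LinkingParityCircles.SpinRatioMoebius :=
  SpinRatioMoebius_of_conformalLimit

/-! ### (I3) `X ∧ 0636 → S`: the complement of the crux inside the sub-problem is exactly clause (iii) -/

theorem info_X_and_0636_S (hX : LinkingParityCircles.SpinRatioMoebius)
    (h0636 : LinkingParityCircles.IsingEuclidUpgradeR4NonGaussian) : _root_.Ising3DConformalLimit := by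
  obtain ⟨ρ, Δ, S, hρ, hΔ, hlim, hnd, hM⟩ := SpinRatioMoebius_iff_moebiusLimit.1 hX
  exact ⟨ρ, Δ, S, hρ, hΔ, hlim, hnd, hM, h0636 ρ S hρ hlim hnd⟩

/-- Hence, inside this route's `closes`, the crux and the shared item 0636 are JOINTLY equivalent to the sub-problem. -/
theorem info_X_and_0636_iff_S :
    (LinkingParityCircles.SpinRatioMoebius ∧ LinkingParityCircles.IsingEuclidUpgradeR4NonGaussian) ↔ _root_.Ising3DConformalLimit :=
  ⟨fun h => info_X_and_0636_S h.1 h.2, fun h => ⟨SpinRatioMoebius_of_conformalLimit h, nonGaussian_of_summit h⟩⟩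

/-! ### (I4) the split glue at ROUTE-LOCAL COPIES (what the gate renders into `Theses/LinkingParityCircles.lean`) -/

namespace LPCcopy
/-- verbatim body of item stmt-6150. -/
def TwoPointDoubling : Prop :=
  ∃ κ : ℝ, 0 < κ ∧ ∀ n : ℕ, 1 ≤ n → κ * Literature.Probability.LatticeModels.criticalTwoPoint 3 (Pi.single 0 (n : ℤ)) ≤ Literature.Probability.LatticeModels.criticalTwoPoint 3 (Pi.single 0 (2 * (n : ℤ)))
/-- verbatim body of item stmt-4659. -/
def ClusterSetTotallyDisconnected : Prop :=
  IsTotallyDisconnected {S : Literature.Probability.LatticeModels.CorrFamily 3 | (∀ n x, x ∉ Literature.Probability.LatticeModels.NonCoincident 3 n → S n x = 0) ∧ ∃ u : ℕ → ℝ, (∀ k, u k ∈ Set.Ioc (0:ℝ) 1) ∧ Filter.Tendsto u Filter.atTop (nhds 0) ∧ ∀ n, TendstoLocallyUniformlyOn (fun k => Literature.Probability.LatticeModels.rescaledCorrelator (Literature.Probability.LatticeModels.criticalCorr 3) (fun δ : ℝ => (Literature.Probability.LatticeModels.criticalTwoPoint 3 (Pi.single 0 ⌊δ⁻¹⌋))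 ^ (-(1/2:ℝ))) n (u k)) (S n) Filter.atTop (Literature.Probability.LatticeModels.NonCoincident 3 n)}
/-- verbatim body of item stmt-1982. -/
def InversionUpgradeNormalised : Prop :=
  ∀ (ρ : ℝ → ℝ) (Δ : ℝ) (S : Literature.Probability.LatticeModels.CorrFamily 3), (∀ δ ∈ Set.Ioc (0:ℝ) 1, 0 < ρ δ) → Literature.Probability.LatticeModels.HasPointwiseScalingLimit (Literature.Probability.LatticeModels.criticalCorr 3) ρ S → (∀ n z, z ∉ Literature.Probability.LatticeModels.NonCoincident 3 n → S n z = 0) → Literature.Probability.LatticeModels.IsNondegenerateTwoPoint S → Literature.Probability.LatticeModels.IsEuclideanInvariant S → Literature.Probability.LatticeModels.IsScaleCovariant Δ S → Literature.Probability.LatticeModels.IsInversionCovariant Δ S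
end LPCcopy

/-- The glue term p164529 is accepted AT THE COPIES by δ-unfolding (this is the proof of the route's glue item). -/
theorem info_glue_at_copies :
    LPCcopy.TwoPointDoubling → LPCcopy.ClusterSetTotallyDisconnected → LPCcopy.InversionUpgradeNormalised →
      LinkingParityCircles.SpinRatioMoebius :=
  SpinRatioMoebius_of_roots_of_inversionUpgrade

/-! ### (I4b) MOCK RENDER of the split as the gate writes it into `Theses/LinkingParityCircles.lean` (children = verbatim shared
signatures under this route's namespace; glue ITEM `SpinRatioMoebiusGlue`), with the ONE-TERM proof that closes the glue item and the
dedup exactness of each child with its home decl (`Iff.rfl`). -/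

namespace MockRender

/-- child 1 (= stmt-6150), as rendered. -/
def TwoPointDoubling : Prop :=
  ∃ κ : ℝ, 0 < κ ∧ ∀ n : ℕ, 1 ≤ n → κ * Literature.Probability.LatticeModels.criticalTwoPoint 3 (Pi.single 0 (n : ℤ)) ≤ Literature.Probability.LatticeModels.criticalTwoPoint 3 (Pi.single 0 (2 * (n : ℤ)))

/-- child 2 (= stmt-4659), as rendered. -/
def ClusterSetTotallyDisconnected : Prop :=
  IsTotallyDisconnected {S : Literature.Probability.LatticeModels.CorrFamily 3 | (∀ n x, x ∉ Literature.Probability.LatticeModels.NonCoincident 3 n → S n x = 0) ∧ ∃ u : ℕ → ℝ, (∀ k, u k ∈ Set.Ioc (0:ℝ) 1) ∧ Filter.Tendsto u Filter.atTop (nhds 0) ∧ ∀ n, TendstoLocallyUniformlyOn (fun k => Literature.Probability.LatticeModels.rescaledCorrelator (Literature.Probability.LatticeModels.criticalCorr 3) (fun δ : ℝ => (Literature.Probability.LatticeModels.criticalTwoPoint 3 (Pi.single 0 ⌊δ⁻¹⌋)) ^ (-(1/2:ℝ))) n (u k)) (S n) Filter.atTop (Literature.Probability.LatticeModels.NonCoincident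 3 n)}

/-- child 3 (= stmt-1982), as rendered. -/
def InversionUpgradeNormalised : Prop :=
  ∀ (ρ : ℝ → ℝ) (Δ : ℝ) (S : Literature.Probability.LatticeModels.CorrFamily 3), (∀ δ ∈ Set.Ioc (0:ℝ) 1, 0 < ρ δ) → Literature.Probability.LatticeModels.HasPointwiseScalingLimit (Literature.Probability.LatticeModels.criticalCorr 3) ρ S → (∀ n z, z ∉ Literature.Probability.LatticeModels.NonCoincident 3 n → S n z = 0) → Literature.Probability.LatticeModels.IsNondegenerateTwoPoint S → Literature.Probability.LatticeModels.IsEuclideanInvariant S → Literature.Probability.LatticeModels.IsScaleCovariant Δ S → Literature.Probability.LatticeModels.IsInversionCovariant Δ S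

/-- the generated glue item `C₁ → C₂ → C₃ → C` (split of `SpinRatioMoebius`, `--glue-decl-name SpinRatioMoebiusGlue`). -/
def SpinRatioMoebiusGlue : Prop :=
  TwoPointDoubling → ClusterSetTotallyDisconnected → InversionUpgradeNormalised → LinkingParityCircles.SpinRatioMoebius

/-- **The glue item closes by ONE TERM** (p164529 at the copies, δ-unfolding). This is the body of the follow-up Theorems file. -/
theorem spinRatioMoebiusGlue_holds : SpinRatioMoebiusGlue :=
  fun hD hT hU => SpinRatioMoebius_of_roots_of_inversionUpgrade hD hT hU

/-- dedup exactness: the rendered children ARE the shared items (definitional). -/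
theorem child1_iff : TwoPointDoubling ↔ MirrorHoelderCompactness.TwoPointDoubling := Iff.rfl
theorem child2_iff : ClusterSetTotallyDisconnected ↔ ClusterRigidity.ClusterSetTotallyDisconnected := Iff.rfl
theorem child3_iff : InversionUpgradeNormalised ↔ HyperoctahedralRP.InversionUpgradeNormalised := Iff.rfl

/-- after the split the parent closes `proved-by-split` from the three children and the glue item: the composition the gate derives. -/
theorem parent_of_family (h1 : TwoPointDoubling) (h2 : ClusterSetTotallyDisconnected) (h3 : InversionUpgradeNormalised)
    (hg : SpinRatioMoebiusGlue) : LinkingParityCircles.SpinRatioMoebius :=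
  hg h1 h2 h3

end MockRender

/-! ### (I5) EXACTNESS of the split and NECESSITY of each piece -/

/-- X → X3 (item 1982): through 1344 (`PerfectScreening.MoebiusLimitExists` has the same body as `EnergyNotSigmaSquared.MoebiusLimit`). -/
theorem info_X3_of_X (h : LinkingParityCircles.SpinRatioMoebius) : HyperoctahedralRP.InversionUpgradeNormalised :=
  inversionUpgradeNormalised_of_MoebiusLimitExists (SpinRatioMoebius_iff_moebiusLimit.1 h)

/-- **X ⇔ X1 ∧ X2 ∧ X3** (exact, not merely sufficient). -/
theorem info_exact :
    LinkingParityCircles.SpinRatioMoebius ↔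
      (MirrorHoelderCompactness.TwoPointDoubling ∧ ClusterRigidity.ClusterSetTotallyDisconnected ∧
        HyperoctahedralRP.InversionUpgradeNormalised) :=
  ⟨fun h => ⟨twoPointDoubling_of_SpinRatioMoebius h, clusterSetTotallyDisconnected_of_SpinRatioMoebius h, info_X3_of_X h⟩,
    fun h => SpinRatioMoebius_of_roots_of_inversionUpgrade h.1 h.2.1 h.2.2⟩

/-- The tight ROOT variant with the lattice item 4840 in place of 1982 (landed p164529). -/
theorem info_exact_roots :
    LinkingParityCircles.SpinRatioMoebius ↔
      (MirrorHoelderCompactness.TwoPointDoubling ∧ ClusterRigidity.ClusterSetTotallyDisconnected ∧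
        CurrentConnectionInvariance.RatioInversionInvariance) :=
  SpinRatioMoebius_iff_roots

/-! ### (I6) the cone after the split is a NAMED conjunct split of the sub-problem -/

/-- S ⇔ (X1 ∧ X2) ∧ X3 ∧ 0636 (summit_iff_three_hubs transported through p139907). -/
theorem info_summit_iff_pieces_and_0636 :
    _root_.Ising3DConformalLimit ↔
      ((MirrorHoelderCompactness.TwoPointDoubling ∧ ClusterRigidity.ClusterSetTotallyDisconnected) ∧
        HyperoctahedralRP.InversionUpgradeNormalised ∧ HyperoctahedralRP.IsingEuclidUpgradeR4NonGaussian) := by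
  rw [summit_iff_three_hubs,
    Summit.CriticalPhenomena.Ising3DConformalLimit.Cruxes.ExistsScaleCovariantLimit.FoldedCurrentRepulsion.crux_iff_doubling_and_totallyDisconnected]

end H21Probe.SpinRatioMoebiusInfo
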